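import Summits.QuantumFields.Balaban3D.Proofs.FibreClash
import Summits.QuantumFields.Balaban3D.Proofs.AxialGaugeShift
import Summits.QuantumFields.Balaban3D.Proofs.FluctGaussSU2
import Literature.MathematicalPhysics.QuantumFieldTheory.Balaban1983to89.T4ReTrLipUnitary

/-!
# `Summit.QuantumFields.Balaban3D.Proofs.FibreZeroSU2` — THE LANE'S TWO RESIDUALS AT THE FIRST STEP, REDUCED: R3D-02 `Fibre57Low` at
# `k = 0` and R3D-01 `Fibre49` at `(k = 0, h′ = triv)`, for `G = SU(2)` and the lane's axial averaging, are EQUIVALENT to two explicit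
# dV-a.e. inequalities between the step pieces' NAMED reals and the COMPUTED right-hand side of [Balaban1985UV3] (22) p. 261
# (seat p4, lane `pub-balaban3d`; step (S4) of HOME/drafts/p4/FIBRE49.md)

HONEST FRAMING (lane PLAN.md §0, binding): see `…Proofs.SectAFirstStep`.  With `R(V) := σ₀^{N} g₀^{3N} Z(V) ∫Ψ_V dμ_V` (`N = |T₁*|` free bonds,
`…FluctGaussSU2`) and `F_P(V) := (log σ₀ + d(𝔤) log g₀)_P·|T₁*|_P + log Z^{(0)}_P(V) + Pold_P(V) + log Fl_P(V)` (the pieces' names):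
* `fibre57Low_zero_iff`:  R3D-02 at `k = 0`  ⟺  `χ₁(V)·e^{F_P(V)} ≤ R(V)` dV-a.e.;
* `fibre49_zero_triv_iff`:  R3D-01 at `(0, triv)`  ⟺  `R(V) ≤ e^{F_P(V)}` dV-a.e.;
* `fibre_pair_zero_of_pins`: with PRINT'S DATA in the pieces (`log σ₀`, `d(𝔤) = 3`, `|T₁*| = N`, `Pold = 0`, `log Z^{(0)} = log Z(V)`, `log Fl =
  log ∫Ψ_V dμ_V`) both hold, MODULO the regularity row `χ₁(V) = 1 ⇒ ∫Ψ_V dμ_V > 0` (b11; `…FibreZeroSU2Regular`).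
Hypotheses, all print's: standing range; `Ū` = the axial average at level 0 (`ExternalInputs.ofStd`); `U₁ := X.Uk 0` in the axial gauge and in the
fibre — (12) p. 258 (`hax`, `hfib`); a measurable quadratic datum `q_V` with `Z(V) > 0` ((19)/(54), binder b9).  [folklore] bookkeeping over
`…FluctGaussSU2`, `…AxialGaugeShift`, `…FibreClash` and the d = 3 scaling `(1/g_k²)A^η_k = (1/g₀²)A` ((36) «g₁ = g(Lε)^{1/2}»); nothing of print asserted.
-/

noncomputable section

namespace Summit.QuantumFields.Balaban3D.Proofs.FibreZeroSU2

open _root_.MeasureTheory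
open Literature.MathematicalPhysics.QuantumFieldTheory.Balaban1983to89
open Literature.MathematicalPhysics.QuantumFieldTheory.Balaban1983to89.AveragingRT (axialAvg rnTransport)
open Literature.MathematicalPhysics.QuantumFieldTheory.Balaban1983to89.GaugeField (GaugeInvariant)
open Literature.MathematicalPhysics.QuantumFieldTheory.Balaban1983to89.B10SectAGathering (StepPieces)
open Literature.MathematicalPhysics.QuantumFieldTheory.Balaban1985CMP102
open Literature.MathematicalPhysics.QuantumFieldTheory.Balaban1985CMP102.Setting
open Summit.QuantumFields.Balaban3D.Carriers
open Summit.QuantumFields.Balaban3D.Proofs.Bound55Std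
open Summit.QuantumFields.Balaban3D.Proofs.Bound55Masses
open Summit.QuantumFields.Balaban3D.Proofs.ProductChartSU2 (SU2)
open Summit.QuantumFields.Balaban3D.Proofs.AxialGaugeFix (forest)
open Summit.QuantumFields.Balaban3D.Proofs.AxialGaugeShift (fluct rnTransport_ae_eq_integral_fluct)
open Summit.QuantumFields.Balaban3D.Proofs.FluctGaussSU2
open Summit.QuantumFields.Balaban3D.Proofs.ChartScalingSU2 (E3)
open Summit.QuantumFields.Balaban3D.Proofs.GaussianNormalization (partZ normalized)

variable {L : ℕ} {S : Scales L}

/-! ## §1 The d = 3 scaling identity and the (1)-exponent -/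

/-- **«g₁ = g(Lε)^{1/2}», d = 3 scaling**: the main term's prefactor and weight combine to the bare coupling at EVERY level,
`(1/g_k²)·A^{η_k}(U) = (1/g₀²)·A(U)` (`g_k² = g²L^kε`, `η_k = L^{−k}`, `A^η = Σ_p η^{−1}[1 − Re tr U(∂p)]`). [cite: Balaban1985UV3, (36) p.265] -/
theorem inv_gk_sq_mul_actionEta {G : Type} [GaugeGroup G] (k : ℕ) (U : GaugeField S.P 0 G) :
    (S.gk k)⁻¹ ^ 2 * S.actionEta k U = S.g0sq⁻¹ * wilsonAction 1 U := by
  have hL : (1 : ℝ) < L := by exact_mod_cast S.hL.2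
  have hL0 : (0 : ℝ) < L := by linarith
  have hε := S.ε_pos
  have hg := S.g_pos
  have hPL : (S.P.L : ℝ) = L := rfl
  have key : (S.g * Real.sqrt ((L : ℝ) ^ k * S.ε))⁻¹ ^ 2 * (((L : ℝ)⁻¹ ^ k)⁻¹) = (S.g ^ 2 * S.ε)⁻¹ := by
    simp only [inv_pow, inv_inv, mul_pow, Real.sq_sqrt (show (0 : ℝ) ≤ (L : ℝ) ^ k * S.ε by positivity)]
    field_simp
  unfold Scales.gk B10.gRun Scales.actionEta Scales.eta Params.eta wilsonAction Scales.g0sq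
  rw [hPL, Finset.mul_sum, Finset.mul_sum]
  refine Finset.sum_congr rfl fun p _ => ?_
  rw [← mul_assoc, key, one_mul]

/-- The exponent of (1): `(1/g₀²)A(U)` on the finest lattice. [cite: Balaban1985UV3, (1) p.256] -/
def act0 {G : Type} [GaugeGroup G] (S : Scales L) (U : GaugeField S.P 0 G) : ℝ := S.g0sq⁻¹ * wilsonAction 1 U

section General

variable {G : Type} [GaugeGroup G] [MeasurableSpace G] [HaarData G] [RegularGaugeGroup G]
  {Val : Type} [NormedAddCommGroup Val] [NormedSpace ℂ Val]
  (X : ExternalInputs S G) (K : CarrierConsts) (𝔖 : ∀ k, StepSeries S G Val (nblkOf S K k) k) (slot : ℕ → Prop)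

omit [HaarData G] in
/-- `(1/g₀²)A ≥ 0`. [folklore] -/
theorem act0_nonneg (U : GaugeField S.P 0 G) : 0 ≤ act0 S U := by
  unfold act0 wilsonAction
  refine mul_nonneg (inv_nonneg.mpr ?_) (Finset.sum_nonneg fun p _ => ?_)
  · unfold Scales.g0sq; have := S.g_pos; have := S.ε_pos; positivity
  · rw [one_mul]; exact (RegularGaugeGroup.one_sub_reTr_mem_Icc _).1

omit [HaarData G] in
/-- `(1/g₀²)A` is measurable. [folklore] -/
theorem measurable_act0 : Measurable (act0 S : GaugeField S.P 0 G → ℝ) := by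
  unfold act0 wilsonAction
  refine measurable_const.mul (Finset.measurable_sum _ fun p _ => ?_)
  exact measurable_const.mul (measurable_const.sub (RegularGaugeGroup.measurable_reTr.comp (Missing.measurable_plaqHol p)))

omit [MeasurableSpace G] [HaarData G] [RegularGaugeGroup G] in
/-- `(1/g₀²)A` is gauge invariant (`Re tr` is a class function). [folklore] -/
theorem act0_gaugeAct (u : GaugeTransf S.P 0 G) (U : GaugeField S.P 0 G) : act0 S (GaugeField.gaugeAct u U) = act0 S U := by
  unfold act0 wilsonAction
  congr 1
  exact Finset.sum_congr rfl fun p _ => by rw [T4ReTrLipUnitary.plaqHol_gaugeAct, GaugeGroup.reTr_conj]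

omit [RegularGaugeGroup G] in
/-- **The main term at the trivial history is `(1/g₀²)A(U_k(V))` at every level** (d = 3 scaling; `U_0 = id`). [cite: Balaban1985UV3, (36) p.265] -/
theorem mainT_triv_eq (k : ℕ) (V : GaugeField S.P k G) :
    ((stdTowerInput X K 𝔖).towerWith slot).mainT k (Hist.triv S.P k) V = act0 S (ukAll X.Uk k V) := by
  show (S.gk k)⁻¹ ^ 2 * S.actionEta k (X.UkH k (Hist.triv S.P k) V) = _
  rw [X.UkH_triv]
  exact inv_gk_sq_mul_actionEta k _

omit [RegularGaugeGroup G] in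
/-- `Rm 0 = 0` (an empty sum of remainders). [folklore] -/
theorem Rm_zero : ((stdTowerInput X K 𝔖).towerWith slot).Rm 0 = 0 := by
  show ∑ j ∈ Finset.range 0, _ = (0 : ℝ)
  exact Finset.sum_range_zero _

omit [RegularGaugeGroup G] in
/-- `Zterm 0 h = 0` (no `Z_j` with `j < 0`). [folklore] -/
theorem Zterm_zero (h : Hist S.P 0) : ((stdTowerInput X K 𝔖).towerWith slot).Zterm 0 h = 0 := by
  show ∑ j ∈ Finset.range 0, _ = (0 : ℝ)
  exact Finset.sum_range_zero _

omit [RegularGaugeGroup G] in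
/-- **The (47)₀ = (1) integrand at the standard tower**: `χ₀(U)·exp[−mainT₀ + Pint₀ − E₀ − Rm₀] = χ₀(U)·e^{−(1/g₀²)A(U)}·e^{−E₀}`
(`Pint₀ = Rm₀ = 0`, `U₀ = id`). [cite: Balaban1985UV3, (1) p.256 + (47) p.267] -/
theorem integrand47_zero_eq (U : GaugeField S.P 0 G) :
    ((stdTowerInput X K 𝔖).towerWith slot).chi 0 U *
        Real.exp (-(((stdTowerInput X K 𝔖).towerWith slot).mainT 0 (Hist.triv S.P 0) U)
          + (stdTowerInput X K 𝔖).Pint 0 (Hist.triv S.P 0) U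
          - ((stdTowerInput X K 𝔖).towerWith slot).Ecst 0 - ((stdTowerInput X K 𝔖).towerWith slot).Rm 0)
      = chiSmall Set.univ (eps1Of S K 0) U * Real.exp (-(act0 S U)) *
          Real.exp (-(((stdTowerInput X K 𝔖).towerWith slot).Ecst 0)) := by
  have hPint : (stdTowerInput X K 𝔖).Pint 0 (Hist.triv S.P 0) U = 0 := rfl
  have hchi : ((stdTowerInput X K 𝔖).towerWith slot).chi 0 U = chiSmall Set.univ (eps1Of S K 0) U := rfl
  rw [hPint, Rm_zero, hchi, mainT_triv_eq, show ukAll X.Uk 0 U = U from rfl, mul_assoc, ← Real.exp_add]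
  congr 1; ring

omit [RegularGaugeGroup G] in
/-- **The (49) integrand at `(k = 0, h′ = triv)` is the (47)₀ integrand**: `w(triv) = 1`, `χB(triv) = χ₀` (v4 threshold `ε₁`), `m₀(triv) = 1`,
`Zterm₀ = Rm₀ = 0`. [cite: Balaban1985UV3, (49) p.268] -/
theorem integrand49_zero_triv_eq :
    (fun U => stepWeight K.M₁ (rcolOf S K) (eps1Of S K) (epsSOf S K) 0 (Hist.triv S.P 1) U *
        chiB K.M₁ (rcolOf S K) (eps1Of S K) 0 (Hist.triv S.P 1) U *
        ((stdTowerInput X K 𝔖).W.mass 0 (Hist.triv S.P 1).proj U *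
          Real.exp (-(((stdTowerInput X K 𝔖).towerWith slot).mainT 0 (Hist.triv S.P 1).proj U)
            + (stdTowerInput X K 𝔖).Pint 0 (Hist.triv S.P 1).proj U
            - ((stdTowerInput X K 𝔖).towerWith slot).Ecst 0
            + ((stdTowerInput X K 𝔖).towerWith slot).Zterm 0 (Hist.triv S.P 1).proj
            + ((stdTowerInput X K 𝔖).towerWith slot).Rm 0)))
      = fun U => ((stdTowerInput X K 𝔖).towerWith slot).chi 0 U *
          Real.exp (-(((stdTowerInput X K 𝔖).towerWith slot).mainT 0 (Hist.triv S.P 0) U)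
            + (stdTowerInput X K 𝔖).Pint 0 (Hist.triv S.P 0) U
            - ((stdTowerInput X K 𝔖).towerWith slot).Ecst 0 - ((stdTowerInput X K 𝔖).towerWith slot).Rm 0) := by
  classical
  funext U
  rw [stepWeight_triv K.M₁ (rcolOf S K) (eps1Of S K) (epsSOf S K) (Nat.zero_le _) U, one_mul, FibreClash.chiB_triv_eq,
    ← FibreClash.chi_eq X K 𝔖 slot 0 U, show (Hist.triv S.P 1).proj = Hist.triv S.P 0 from rfl,
    stdTowerInput_mass_triv X K 𝔖 0 U, one_mul, Zterm_zero, Rm_zero]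
  congr 2; ring

/-- The pieces' exponent at the trivial history, WITHOUT the main term and `E₀`: `F_P(V) = (log σ₀ + d(𝔤) log g₀)_P·|T₁*|_P(triv) +
log Z^{(0)}_P(triv, V) + Pold_P(triv, V) + log Fl_P(triv, V)` — the four NAMED reals of (22)/(55)·(58) the residuals constrain. [cite: Balaban1985UV3, (22) p.261] -/
def pieceExp (P : StepPieces ((stdTowerInput X K 𝔖).towerWith slot).toTowerRun 0) (V : GaugeField S.P 1 G) : ℝ :=
  (P.logσ₀ + P.dg * Real.log (S.gk 0)) * P.starB (Hist.triv S.P 1) + P.logZU (Hist.triv S.P 1) V + P.Pold (Hist.triv S.P 1) V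
    + P.logFl (Hist.triv S.P 1) V

end General

/-! ## §2 G = SU(2): the transported first-step integrand, computed -/

variable {Val : Type} [NormedAddCommGroup Val] [NormedSpace ℂ Val] [DecidableEq (PBond S.P 0)]
  (X : ExternalInputs S SU2) (K : CarrierConsts) (𝔖 : ∀ k, StepSeries S SU2 Val (nblkOf S K k) k) (slot : ℕ → Prop)

/-- **THE COMPUTED RIGHT-HAND SIDE OF (22) at Ω₁ = T** (without `e^{−(1/g₀²)A(U₁)}` and `e^{−E₀}`): `R(V) := σ₀^{N} · g₀^{3N} · Z(V) · ∫ Ψ_V dμ_V`,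
`N = |T₁*|` = #free bonds, `g₀ = g_0 = gε^{1/2}`, `Ψ_V` = `FluctGaussSU2.fluctIntegrand` of `(1/g₀²)A` and `χ₀`, background `U₁ = X.Uk 0`, quadratic
datum `q_V`. [cite: Balaban1985UV3, (22) p.261] -/
def gauss22 (q : GaugeField S.P 1 SU2 → (Free S.P 0 → E3) → ℝ) (V : GaugeField S.P 1 SU2) : ℝ :=
  sigma0 ^ Fintype.card (Free S.P 0) * S.gk 0 ^ (3 * Fintype.card (Free S.P 0)) *
    partZ (volume : Measure (Free S.P 0 → E3)) (q V) *
    ∫ A, fluctIntegrand (act0 S) (chiSmall Set.univ (eps1Of S K 0)) q (X.Uk 0) (S.gk 0) V A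
      ∂(normalized (volume : Measure (Free S.P 0 → E3)) (q V))

/-- **`T[(47)₀ integrand](V) = e^{−E₀} · e^{−(1/g₀²)A(U₁(V))} · R(V)` dV-a.e.** — (10)+(12)+(13)+(18)+(22) for the lane's axial averaging at level 0,
G = SU(2), Ω₁ = T, background `U₁ = X.Uk 0` in the axial gauge with `Ū₁ = V`. [cite: Balaban1985UV3, (13)–(22) pp.259–261] -/
theorem transport47_zero_ae_eq (hj : 1 ≤ S.P.m + S.P.K) (hav : (X.av 0).avg = axialAvg)
    (hax : ∀ V, ∀ b ∈ forest S.P 0, X.Uk 0 V b = 1) (hfib : ∀ V, axialAvg (X.Uk 0 V) = V)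
    (q : GaugeField S.P 1 SU2 → (Free S.P 0 → E3) → ℝ) (hqm : ∀ V, Measurable (q V))
    (hZ : ∀ V, 0 < partZ (volume : Measure (Free S.P 0 → E3)) (q V)) :
    rnTransport (X.av 0).avg (fun U => ((stdTowerInput X K 𝔖).towerWith slot).chi 0 U *
        Real.exp (-(((stdTowerInput X K 𝔖).towerWith slot).mainT 0 (Hist.triv S.P 0) U)
          + (stdTowerInput X K 𝔖).Pint 0 (Hist.triv S.P 0) U
          - ((stdTowerInput X K 𝔖).towerWith slot).Ecst 0 - ((stdTowerInput X K 𝔖).towerWith slot).Rm 0))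
      =ᵐ[fieldMeasure S.P 1 SU2] fun V =>
        Real.exp (-(((stdTowerInput X K 𝔖).towerWith slot).Ecst 0)) * (Real.exp (-(act0 S (X.Uk 0 V))) * gauss22 X K q V) := by
  set E₀ : ℝ := ((stdTowerInput X K 𝔖).towerWith slot).Ecst 0 with hE₀
  set χ₀ : GaugeField S.P 0 SU2 → ℝ := chiSmall Set.univ (eps1Of S K 0) with hχ₀
  set ρ : Density S.P 0 SU2 := fun U => χ₀ U * Real.exp (-(act0 S U)) * Real.exp (-E₀) with hρ
  have hint : (fun U => ((stdTowerInput X K 𝔖).towerWith slot).chi 0 U *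
      Real.exp (-(((stdTowerInput X K 𝔖).towerWith slot).mainT 0 (Hist.triv S.P 0) U)
        + (stdTowerInput X K 𝔖).Pint 0 (Hist.triv S.P 0) U - E₀ - ((stdTowerInput X K 𝔖).towerWith slot).Rm 0)) = ρ := by
    funext U; rw [hρ]; exact integrand47_zero_eq X K 𝔖 slot U
  have hχm : Measurable χ₀ := T4AxialGaugeFixing.measurable_chiSmall _ _
  have hχb : ∀ U, |χ₀ U| ≤ 1 := fun U => by rw [hχ₀]; unfold chiSmall; split_ifs <;> simp
  have hρm : Measurable ρ :=
    ((hχm.mul (Real.measurable_exp.comp (measurable_act0 (S := S)).neg)).mul measurable_const)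
  have hρb : ∀ U, |ρ U| ≤ Real.exp (-E₀) := fun U => by
    rw [hρ]; simp only
    rw [abs_mul, abs_mul, Real.abs_exp, Real.abs_exp]
    exact mul_le_of_le_one_left (Real.exp_pos _).le
      (mul_le_one₀ (hχb U) (Real.exp_pos _).le (Real.exp_le_one_iff.mpr (neg_nonpos.mpr (act0_nonneg U))))
  have hρi : Integrable ρ (fieldMeasure S.P 0 SU2) := AveragingRT.integrable_of_abs_le hρm _ hρb
  have hρinv : GaugeInvariant ρ := fun u U => by
    simp only [hρ, hχ₀, T4SmallFieldWindowSandwich.chiSmall_gaugeAct, act0_gaugeAct]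
  rw [hint, hav]
  refine (rnTransport_ae_eq_integral_fluct hj ρ hρi hρm hρinv (X.Uk 0) hax hfib).trans (Filter.Eventually.of_forall fun V => ?_)
  have hg : 0 < S.gk 0 := B10.gRun_pos _ _ _ S.g_pos (by have := S.hL.2; exact_mod_cast (by omega : 0 < L)) S.ε_pos 0
  have h22 := fluct_integral_eq_gauss hj (act0 S) χ₀ measurable_act0 act0_nonneg hχm hχb q (X.Uk 0) hg V (hqm V) (hZ V)
  simp only [hρ]
  rw [integral_mul_const, h22]
  unfold gauss22
  ring

/-! ## §3 The two residuals at the first step, reduced -/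

/-- **R3D-02 AT `k = 0` REDUCED**: `Fibre57Low X K 𝔖 slot 0 P` ⟺ `χ₁(V) · e^{F_P(V)} ≤ R(V)` for dV-a.e. `V` — the main term `(1/g₁²)A^{L⁻¹}(U₁(V)) =
(1/g₀²)A(U₁(V))` and `E₀` cancel against the computed transport. [cite: Balaban1985UV3, p.265 L21–28 + (22) p.261] -/
theorem fibre57Low_zero_iff (hj : 1 ≤ S.P.m + S.P.K) (P : StepPieces ((stdTowerInput X K 𝔖).towerWith slot).toTowerRun 0)
    (hav : (X.av 0).avg = axialAvg) (hax : ∀ V, ∀ b ∈ forest S.P 0, X.Uk 0 V b = 1) (hfib : ∀ V, axialAvg (X.Uk 0 V) = V)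
    (q : GaugeField S.P 1 SU2 → (Free S.P 0 → E3) → ℝ) (hqm : ∀ V, Measurable (q V))
    (hZ : ∀ V, 0 < partZ (volume : Measure (Free S.P 0 → E3)) (q V)) :
    Fibre57Low X K 𝔖 slot 0 P ↔
      ∀ᵐ V ∂(fieldMeasure S.P 1 SU2), chiSmall Set.univ (eps1Of S K 1) V * Real.exp (pieceExp X K 𝔖 slot P V) ≤ gauss22 X K q V := by
  have hT := transport47_zero_ae_eq X K 𝔖 slot hj hav hax hfib q hqm hZ
  set E₀ : ℝ := ((stdTowerInput X K 𝔖).towerWith slot).Ecst 0 with hE₀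
  -- the left-hand side of (57)₀, pointwise
  have hL : ∀ V : GaugeField S.P 1 SU2, ((stdTowerInput X K 𝔖).towerWith slot).chi 1 V *
      Real.exp (-(((stdTowerInput X K 𝔖).towerWith slot).mainT 1 (Hist.triv S.P 1) V) - E₀
        + (P.logσ₀ + P.dg * Real.log (S.gk 0)) * P.starB (Hist.triv S.P 1) + P.logZU (Hist.triv S.P 1) V
        + P.Pold (Hist.triv S.P 1) V - ((stdTowerInput X K 𝔖).towerWith slot).Rm 0 + P.logFl (Hist.triv S.P 1) V)
      = Real.exp (-E₀) * Real.exp (-(act0 S (X.Uk 0 V))) *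
          (chiSmall Set.univ (eps1Of S K 1) V * Real.exp (pieceExp X K 𝔖 slot P V)) := fun V => by
    rw [mainT_triv_eq, show ukAll X.Uk 1 V = X.Uk 0 V from rfl, Rm_zero,
      show ((stdTowerInput X K 𝔖).towerWith slot).chi 1 V = chiSmall Set.univ (eps1Of S K 1) V from rfl]
    have : Real.exp (-(act0 S (X.Uk 0 V)) - E₀ + (P.logσ₀ + P.dg * Real.log (S.gk 0)) * P.starB (Hist.triv S.P 1)
        + P.logZU (Hist.triv S.P 1) V + P.Pold (Hist.triv S.P 1) V - 0 + P.logFl (Hist.triv S.P 1) V)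
        = Real.exp (-E₀) * Real.exp (-(act0 S (X.Uk 0 V))) * Real.exp (pieceExp X K 𝔖 slot P V) := by
      rw [← Real.exp_add, ← Real.exp_add]; congr 1; unfold pieceExp; ring
    rw [this]; ring
  have hpos : ∀ V : GaugeField S.P 1 SU2, 0 < Real.exp (-E₀) * Real.exp (-(act0 S (X.Uk 0 V))) := fun V =>
    mul_pos (Real.exp_pos _) (Real.exp_pos _)
  have hassoc : ∀ V : GaugeField S.P 1 SU2, Real.exp (-E₀) * (Real.exp (-(act0 S (X.Uk 0 V))) * gauss22 X K q V)
      = Real.exp (-E₀) * Real.exp (-(act0 S (X.Uk 0 V))) * gauss22 X K q V := fun V => (mul_assoc _ _ _).symm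
  unfold Fibre57Low
  constructor
  · intro h
    filter_upwards [h.trans_eq hT] with V hV
    rw [hL V, hassoc V] at hV
    exact (mul_le_mul_iff_right₀ (hpos V)).mp hV
  · intro h
    refine Filter.EventuallyLE.trans_eq ?_ hT.symm
    filter_upwards [h] with V hV
    rw [hL V, hassoc V]
    exact (mul_le_mul_iff_right₀ (hpos V)).mpr hV

/-- **R3D-01 AT `(k = 0, h′ = triv)` REDUCED**: `Fibre49 X K 𝔖 slot 0 P triv` ⟺ `R(V) ≤ e^{F_P(V)}` for dV-a.e. `V` (the transport of the weight
`w(triv)·m₀ = 1` is `1` a.e. by Haar compatibility). [cite: Balaban1985UV3, (49)–(58) pp.268–270 + (22) p.261] -/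
theorem fibre49_zero_triv_iff (hj : 1 ≤ S.P.m + S.P.K) (P : StepPieces ((stdTowerInput X K 𝔖).towerWith slot).toTowerRun 0)
    (hav : (X.av 0).avg = axialAvg) (hax : ∀ V, ∀ b ∈ forest S.P 0, X.Uk 0 V b = 1) (hfib : ∀ V, axialAvg (X.Uk 0 V) = V)
    (q : GaugeField S.P 1 SU2 → (Free S.P 0 → E3) → ℝ) (hqm : ∀ V, Measurable (q V))
    (hZ : ∀ V, 0 < partZ (volume : Measure (Free S.P 0 → E3)) (q V)) :
    Fibre49 X K 𝔖 slot 0 P (Hist.triv S.P 1) ↔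
      ∀ᵐ V ∂(fieldMeasure S.P 1 SU2), gauss22 X K q V ≤ Real.exp (pieceExp X K 𝔖 slot P V) := by
  have hT := transport47_zero_ae_eq X K 𝔖 slot hj hav hax hfib q hqm hZ
  set E₀ : ℝ := ((stdTowerInput X K 𝔖).towerWith slot).Ecst 0 with hE₀
  -- `T 1 = 1` a.e. (Haar compatibility of `Ū`)
  have hR : (fun U => stepWeight K.M₁ (rcolOf S K) (eps1Of S K) (epsSOf S K) 0 (Hist.triv S.P 1) U *
      (stdTowerInput X K 𝔖).W.mass 0 (Hist.triv S.P 1).proj U) = fun _ => (1 : ℝ) := by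
    funext U
    rw [stepWeight_triv K.M₁ (rcolOf S K) (eps1Of S K) (epsSOf S K) (Nat.zero_le _) U, one_mul,
      show (Hist.triv S.P 1).proj = Hist.triv S.P 0 from rfl, stdTowerInput_mass_triv X K 𝔖 0 U]
  have hone : rnTransport (X.av 0).avg (fun _ => (1 : ℝ)) =ᵐ[fieldMeasure S.P 1 SU2] fun _ => (1 : ℝ) :=
    RTAlgebra.IsRT.ae_eq (isRT_rnTransport_of_ac (X.avgAC 0) _ (integrable_const _))
      (Transport48.isRT_one_of_map (X.av_meas 0) (X.av_map 0)) (X.av_meas 0)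
      (integrable_const _) (integrable_rnTransport (X.av 0).avg _ (integrable_const _)) (integrable_const _)
  -- the right-hand side of (49) at triv, a.e.
  have hRHS : (fun V => rnTransport (X.av 0).avg (fun U =>
        stepWeight K.M₁ (rcolOf S K) (eps1Of S K) (epsSOf S K) 0 (Hist.triv S.P 1) U *
          (stdTowerInput X K 𝔖).W.mass 0 (Hist.triv S.P 1).proj U) V *
      Real.exp (-(((stdTowerInput X K 𝔖).towerWith slot).mainT 1 (Hist.triv S.P 1) V) - E₀
        + (P.logσ₀ + P.dg * Real.log (S.gk 0)) * P.starB (Hist.triv S.P 1) + P.logZU (Hist.triv S.P 1) V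
        + P.Pold (Hist.triv S.P 1) V
        + ((stdTowerInput X K 𝔖).towerWith slot).Zterm 0 (P.proj (Hist.triv S.P 1))
        + ((stdTowerInput X K 𝔖).towerWith slot).Rm 0 + P.logFl (Hist.triv S.P 1) V))
      =ᵐ[fieldMeasure S.P 1 SU2] fun V =>
        Real.exp (-E₀) * Real.exp (-(act0 S (X.Uk 0 V))) * Real.exp (pieceExp X K 𝔖 slot P V) := by
    rw [hR]
    filter_upwards [hone] with V hV
    rw [hV, one_mul, mainT_triv_eq, show ukAll X.Uk 1 V = X.Uk 0 V from rfl, Zterm_zero, Rm_zero, ← Real.exp_add,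
      ← Real.exp_add]
    congr 1; unfold pieceExp; ring
  have hpos : ∀ V : GaugeField S.P 1 SU2, 0 < Real.exp (-E₀) * Real.exp (-(act0 S (X.Uk 0 V))) := fun V =>
    mul_pos (Real.exp_pos _) (Real.exp_pos _)
  unfold Fibre49
  rw [integrand49_zero_triv_eq X K 𝔖 slot]
  constructor
  · intro h
    filter_upwards [hT.symm.trans_le (h.trans_eq hRHS)] with V hV
    rw [← mul_assoc] at hV
    exact (mul_le_mul_iff_right₀ (hpos V)).mp hV
  · intro h
    refine hT.trans_le (Filter.EventuallyLE.trans_eq ?_ hRHS.symm)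
    filter_upwards [h] with V hV
    rw [← mul_assoc]
    exact (mul_le_mul_iff_right₀ (hpos V)).mpr hV

/-! ## §4 Print's data: both residuals at the first step, modulo the regularity row -/

omit [DecidableEq (PBond S.P 0)] in
/-- The fluctuation integrand of a non-negative `χ` is non-negative. [folklore] -/
theorem fluctIntegrand_nonneg {P : Params} {j : ℕ} [DecidableEq (PBond P j)] (Sa χ : GaugeField P j SU2 → ℝ) (hχ : ∀ U, 0 ≤ χ U)
    (q : GaugeField P (j + 1) SU2 → (Free P j → E3) → ℝ) (U₁ : GaugeField P (j + 1) SU2 → GaugeField P j SU2) (g₀ : ℝ)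
    (V : GaugeField P (j + 1) SU2) (A : Free P j → E3) : 0 ≤ fluctIntegrand Sa χ q U₁ g₀ V A := by
  unfold fluctIntegrand
  refine mul_nonneg (mul_nonneg (mul_nonneg (Set.indicator_nonneg (fun _ _ => zero_le_one) _) (hχ _))
    (Finset.prod_nonneg fun i _ => div_nonneg (T4HaarSU2ExpChart.expWeight_nonneg _) sigma0_pos.le)) (Real.exp_pos _).le

/-- **PRINT'S DATA DISCHARGE BOTH RESIDUALS AT THE FIRST STEP, MODULO REGULARITY.**  If the step pieces carry, at the trivial history, the
printed values — `log σ₀` with `σ₀ = σ(0)`, `d(𝔤) = 3 = dim SU(2)`, `|T₁*|` = the number of free bonds, no previous-scale terms at `k = 0`,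
`log Z^{(0)}(T₁, U₁) = log Z(V)`, and `log Fl = log ∫Ψ_V dμ_V` (the fluctuation integral of (22)) — then R3D-01 at `(0, triv)` and R3D-02 at `0` hold,
PROVIDED the regularity row `hreg`: small coarse plaquettes (`χ₁(V) = 1`) force a non-null fluctuation integrand (b11; discharged from the
minimizer's regularity in `…FibreZeroSU2Regular`). [cite: Balaban1985UV3, (22) p.261 + p.265 L21–28] -/
theorem fibre_pair_zero_of_pins (hj : 1 ≤ S.P.m + S.P.K) (P : StepPieces ((stdTowerInput X K 𝔖).towerWith slot).toTowerRun 0)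
    (hav : (X.av 0).avg = axialAvg) (hax : ∀ V, ∀ b ∈ forest S.P 0, X.Uk 0 V b = 1) (hfib : ∀ V, axialAvg (X.Uk 0 V) = V)
    (q : GaugeField S.P 1 SU2 → (Free S.P 0 → E3) → ℝ) (hqm : ∀ V, Measurable (q V))
    (hZ : ∀ V, 0 < partZ (volume : Measure (Free S.P 0 → E3)) (q V))
    (hσ : P.logσ₀ = Real.log sigma0) (hdg : P.dg = 3) (hstar : P.starB (Hist.triv S.P 1) = Fintype.card (Free S.P 0))
    (hPold : ∀ V, P.Pold (Hist.triv S.P 1) V = 0)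
    (hZU : ∀ V, P.logZU (Hist.triv S.P 1) V = Real.log (partZ (volume : Measure (Free S.P 0 → E3)) (q V)))
    (hFl : ∀ V, P.logFl (Hist.triv S.P 1) V =
      Real.log (∫ A, fluctIntegrand (act0 S) (chiSmall Set.univ (eps1Of S K 0)) q (X.Uk 0) (S.gk 0) V A
        ∂(normalized (volume : Measure (Free S.P 0 → E3)) (q V))))
    (hreg : ∀ V, PlaqSmall (eps1Of S K 1) V →
      0 < ∫ A, fluctIntegrand (act0 S) (chiSmall Set.univ (eps1Of S K 0)) q (X.Uk 0) (S.gk 0) V A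
        ∂(normalized (volume : Measure (Free S.P 0 → E3)) (q V))) :
    Fibre49 X K 𝔖 slot 0 P (Hist.triv S.P 1) ∧ Fibre57Low X K 𝔖 slot 0 P := by
  classical
  have hg : 0 < S.gk 0 := B10.gRun_pos _ _ _ S.g_pos (by have := S.hL.2; exact_mod_cast (by omega : 0 < L)) S.ε_pos 0
  set N : ℕ := Fintype.card (Free S.P 0) with hN
  -- the pieces' exponent with print's data, per `V`
  have key : ∀ V : GaugeField S.P 1 SU2,
      let I := ∫ A, fluctIntegrand (act0 S) (chiSmall Set.univ (eps1Of S K 0)) q (X.Uk 0) (S.gk 0) V A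
        ∂(normalized (volume : Measure (Free S.P 0 → E3)) (q V))
      Real.exp (pieceExp X K 𝔖 slot P V) =
        sigma0 ^ N * S.gk 0 ^ (3 * N) * partZ (volume : Measure (Free S.P 0 → E3)) (q V) * Real.exp (Real.log I) := by
    intro V I
    have e1 : Real.exp (Real.log sigma0 * N) = sigma0 ^ N := by rw [mul_comm, Real.exp_nat_mul, Real.exp_log sigma0_pos]
    have e2 : Real.exp (3 * Real.log (S.gk 0) * N) = S.gk 0 ^ (3 * N) := by
      rw [show (3 : ℝ) * Real.log (S.gk 0) * N = ((3 * N : ℕ) : ℝ) * Real.log (S.gk 0) by push_cast; ring, Real.exp_nat_mul,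
        Real.exp_log hg]
    unfold pieceExp
    rw [hσ, hdg, hstar, hPold, hZU, hFl, add_zero, add_mul, Real.exp_add, Real.exp_add, Real.exp_add, e1, e2, Real.exp_log (hZ V)]
  have hI0 : ∀ V : GaugeField S.P 1 SU2, 0 ≤ ∫ A, fluctIntegrand (act0 S) (chiSmall Set.univ (eps1Of S K 0)) q (X.Uk 0) (S.gk 0) V A
      ∂(normalized (volume : Measure (Free S.P 0 → E3)) (q V)) := fun V =>
    integral_nonneg fun A => fluctIntegrand_nonneg _ _ (fun U => by unfold chiSmall; split_ifs <;> norm_num) _ _ _ _ _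
  have hC0 : ∀ V : GaugeField S.P 1 SU2, 0 ≤ sigma0 ^ N * S.gk 0 ^ (3 * N) * partZ (volume : Measure (Free S.P 0 → E3)) (q V) :=
    fun V => mul_nonneg (mul_nonneg (pow_nonneg sigma0_pos.le _) (pow_nonneg hg.le _)) (hZ V).le
  refine ⟨(fibre49_zero_triv_iff X K 𝔖 slot hj P hav hax hfib q hqm hZ).mpr (Filter.Eventually.of_forall fun V => ?_),
    (fibre57Low_zero_iff X K 𝔖 slot hj P hav hax hfib q hqm hZ).mpr (Filter.Eventually.of_forall fun V => ?_)⟩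
  · -- upper: `R ≤ e^{F_P}` (equality when `∫Ψ > 0`; `R = 0 ≤ e^{F_P}` otherwise)
    rw [key V]
    unfold gauss22
    refine mul_le_mul_of_nonneg_left ?_ (hC0 V)
    rcases (hI0 V).eq_or_lt with h0 | hpos
    · rw [← h0]; exact (Real.exp_pos _).le
    · rw [Real.exp_log hpos]
  · -- lower: `χ₁ e^{F_P} ≤ R` (equality on `{χ₁ = 1}` by `hreg`; trivial on `{χ₁ = 0}`)
    by_cases hs : PlaqSmall (eps1Of S K 1) V
    · have hpos := hreg V hs
      have hχ1 : chiSmall Set.univ (eps1Of S K 1) V ≤ 1 := by unfold chiSmall; split_ifs <;> norm_num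
      rw [key V, Real.exp_log hpos]
      unfold gauss22
      calc chiSmall Set.univ (eps1Of S K 1) V * _ ≤ 1 * _ :=
            mul_le_mul_of_nonneg_right hχ1 (mul_nonneg (hC0 V) hpos.le)
        _ = _ := one_mul _
    · have hχ0 : chiSmall Set.univ (eps1Of S K 1) V = 0 := by
        unfold chiSmall
        rw [if_neg (fun H => hs fun p => H p (Set.mem_univ p))]
      rw [hχ0, zero_mul]
      unfold gauss22
      exact mul_nonneg (hC0 V) (hI0 V)

end Summit.QuantumFields.Balaban3D.Proofs.FibreZeroSU2

end
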